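import Literature.Analysis.Convex.SchauderFixedPoint
import Mathlib.Topology.Algebra.Group.Pointwise
import Mathlib.Analysis.Normed.Module.Basic
import HarnessLib

/-!
# Nakao's numerical verification principle for fixed-point equations `u = F(u)`

Topic `Literature/Analysis/ValidatedNumerics` (everything PROVED; no definitions, no named facts).
The functional-analytic soundness statement behind Nakao's finite-element verification methods
for semilinear elliptic boundary value problems (FN-Int / FN-Norm), M. T. Nakao, *Numerical
verification methods for solutions of ordinary and partial differential equations*, Numer. Funct.
Anal. Optim. 22 (2001) §3 [Nakao2001], and M. T. Nakao, Y. Watanabe, NOLTA 2 (2011) §2.4–§3.1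
[NakaoWatanabe2011]. AS PRINTED (Nakao 2001, §3, (3.6)–(3.9), p. 329): the boundary value problem is
rewritten as `u = F(u)` with `F := K f` a compact map on `X = H¹₀(Ω)`; "if we find a nonempty,
bounded, convex and closed subset `U` in `H¹₀` satisfying `F(U) = {F(u) | u ∈ U} ⊂ U` (3.7), then by
the Schauder fixed point theorem, there exists an element `u ∈ F(U)` such that `u = F(u)`. Usually,
we choose such a set, which is referred a candidate set of solutions, of the form `U = U_h ⊕ U_⊥`,
where `U_h ⊂ S_h` and `U_⊥ ⊂ S_h^⊥`. Then, the verification condition can be written as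
`P_h F(U) ⊂ U_h`, `(I − P_h) F(U) ⊂ U_⊥` (3.8) … `R(F(U)) := P_h F(U)` [the rounding] and
`RE(F(U)) := (I − P_h) F(U)` [the rounding error] … Then (3.8) implies that
`R(F(U)) ⊕ RE(F(U)) ⊂ U` (3.9), which is the basic principle of our verification method. The set
`U_h` is taken to be a set of linear combinations of base functions in `S_h` with interval
coefficients, while `U_⊥` a ball in `S_h^⊥`" — (3.11): `U_⊥ = {φ ∈ S_h^⊥ : ‖φ‖_{H¹₀} ≤ α}`; and the
computable Theorem 3.1 (p. 331, with (3.18) `β := C₀ h · sup_{u ∈ U} ‖f(u)‖_{L²}`): "if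
`B_i ⊂ u_i + A_i`, `i = 1, …, n`, and `β ≤ α` hold, then there exists a solution `u` of `u = F(u)`
in `U`", the bound `β ≤ α` giving `(I − P_h)F(U) ⊂ U_⊥` through the constructive a priori estimate
`‖Kψ − P_h Kψ‖_{H¹₀} ≤ C₀ h ‖ψ‖_{L²}` ((3.3)/(3.13); NOLTA 2011 (8) and Thm 1, §3.1). The same
principle with the Newton-like compact operator `T` in place of `F` is NOLTA 2011 §2.4 (16)–(17):
"the Schauder fixed-point theorem asserts that if for a nonempty, bounded, convex and closed set
`U ⊂ H¹₀(Ω)`, `TU ⊂ U` holds, then there exists a fixed-point of `T` in `U` … If a candidate set `U`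
is chosen such as [`U = U_h ⊕ [α]`] then the verification condition `TU ⊂ U` can be written by
[`P_h TU ⊂ U_h`, `(I − P_h)TU ⊂ [α]`]".

We state the principle ABSTRACTLY, for a real normed space `X`, any map `P : X → X` in the role of
the projection `P_h` (only the ball form uses that `P` is an idempotent continuous linear map, to
say "`S_h^⊥`" as `ker P`), a compact convex finite part `U_h` (in the method: interval coefficients
on a finite basis, a compact subset of `S_h`) and a closed convex infinite part `U_⊥`; `U_h ⊕ U_⊥` is
the Minkowski sum `U_h + U_⊥`, which is closed because `U_h` is compact, and compactness of `F` on
`U` is the hypothesis `IsCompact (closure (F '' U))` (in the method: `K = (−Δ)⁻¹ : L² → H¹₀` compact,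
Rellich). The proofs are one application of the tree's Schauder theorem
`Literature.Analysis.Convex.exists_fixedPoint_of_isCompact_closure`.

## Main results (all in `Literature.Analysis.ValidatedNumerics`)

* `mapsTo_add_of_split` — (3.8) ⟹ (3.9): `P F(U) ⊆ U_h`, `(I − P)F(U) ⊆ U_⊥` ⟹ `F(U) ⊆ U_h + U_⊥`.
* `exists_fixedPoint_of_projectionSplit` — **the principle**: `U_h` nonempty compact convex, `U_⊥`
  nonempty closed convex, `F` continuous and compact on `U = U_h + U_⊥` with (3.8) ⟹ `∃ u ∈ U, F u = u`.
* `exists_fixedPoint_of_projectionSplit_ball` — the form with `U_⊥ = {φ : P φ = 0, ‖φ‖ ≤ α}` (3.11)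
  for an idempotent continuous linear `P`, the rounding-error condition being `‖F u − P (F u)‖ ≤ α`.
* `norm_sub_apply_comp_le` — the a priori estimate `‖Kψ − P Kψ‖ ≤ C‖ψ‖` and `‖f u‖ ≤ M` on `U` give
  `‖F u − P (F u)‖ ≤ C M` for `F = K ∘ f` (the mechanism of Nakao 2001 Thm 3.1 / NOLTA 2011 Thm 1).
* `exists_fixedPoint_of_aprioriEstimate` — **abstract Theorem 3.1**: `F = K ∘ f`, `K` compact,
  `f(U)` bounded by `M`, rounding `P F(U) ⊆ U_h`, and `C · M ≤ α` ⟹ a solution of `u = F(u)` in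
  `U = U_h + {φ : P φ = 0, ‖φ‖ ≤ α}`.

What is NOT here: the finite-element layer (the spaces `H¹₀`, `S_h`, the Ritz projection, the
constants `C(h) = h/π, h/(2π), 0.493 h`, the interval linear system `G · (B_i) = b` of Theorem 3.1 /
NOLTA Thm 2) — these instantiate `P`, `K`, `C`, `U_h` and are the client's computation; and the
local-uniqueness (Banach/Newton–Kantorovich, FN-NK / IN-Linz) variants (see
`Literature/Analysis/Calculus/PlumExistenceEnclosure.lean`, `RadiiPolynomial.lean`).

## References

* [Nakao2001] M. T. Nakao, *Numerical verification methods for solutions of ordinary and partial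
  differential equations*, Numer. Funct. Anal. Optim. 22 (2001) 321–356, §3 (3.6)–(3.11), Thm 3.1.
  doi:10.1081/NFA-100105107 (held: `paper:doi-10-1081-nfa-100105107`, pp. 9–11).
* [NakaoWatanabe2011] M. T. Nakao, Y. Watanabe, *Numerical verification methods for solutions of
  semilinear elliptic boundary value problems*, NOLTA IEICE 2 (2011) 2–31, §2.4 (16)–(17), §3.1 Thm 1.
  doi:10.1587/nolta.2.2 (held: `paper:doi-10-1587-nolta-2-2`, chunks 13–16).
* [GilbargTrudinger2001] for Schauder's theorem (via `Literature.Analysis.Convex.SchauderFixedPoint`).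
-/

noncomputable section

open Set Metric

open scoped Pointwise Topology

namespace Literature.Analysis.ValidatedNumerics

variable {X : Type*} [NormedAddCommGroup X] [NormedSpace ℝ X]

omit [NormedSpace ℝ X] in
/-- **(3.8) implies (3.9).** If the "rounding" `P (F u)` lies in `U_h` and the "rounding error"
`F u − P (F u)` lies in `U_⊥` for every `u ∈ U`, then `F` maps `U` into `U_h + U_⊥`
(Nakao 2001, §3: "(3.8) implies that `R(F(U)) ⊕ RE(F(U)) ⊂ U` (3.9)"). Here `P` is any map.
[cite: Nakao2001, §3 (3.8)–(3.9)] -/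
theorem mapsTo_add_of_split (P : X → X) {U Uh Ut : Set X} {F : X → X}
    (hR : ∀ u ∈ U, P (F u) ∈ Uh) (hRE : ∀ u ∈ U, F u - P (F u) ∈ Ut) :
    MapsTo F U (Uh + Ut) := by
  intro u hu
  have : F u = P (F u) + (F u - P (F u)) := by abel
  rw [this]
  exact Set.add_mem_add (hR u hu) (hRE u hu)

omit [NormedSpace ℝ X] in
/-- The candidate set `U_h + U_⊥` is closed when `U_h` is compact and `U_⊥` is closed. [folklore] -/
private theorem isClosed_add_of_isCompact {Uh Ut : Set X} (hUh : IsCompact Uh) (hUt : IsClosed Ut) :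
    IsClosed (Uh + Ut) :=
  hUt.add_left_of_isCompact hUh

/-- **Nakao's verification principle** (Nakao 2001 §3 (3.7)–(3.9); Nakao–Watanabe 2011 §2.4
(16)–(17)), abstract form. Let `X` be a real normed space, `P : X → X` any map (the projection
`P_h` onto the finite element space `S_h`), `U_h` a nonempty compact convex set (the finite part:
interval coefficients on a basis of `S_h`), `U_⊥` a nonempty closed convex set (the infinite part),
and `U = U_h + U_⊥` the candidate set. If `F` is continuous on `U` with `closure F(U)` compact
(`F` "a compact map") and the verification condition (3.8) holds — `P (F u) ∈ U_h` and
`F u − P (F u) ∈ U_⊥` for all `u ∈ U` — then `F(U) ⊆ U` and, by the Schauder fixed point theorem,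
`F` has a fixed point in `U`: "there exists an element `u ∈ F(U)` such that `u = F(u)`".
[cite: Nakao2001, §3 (3.7)–(3.9)] -/
theorem exists_fixedPoint_of_projectionSplit (P : X → X) {Uh Ut : Set X}
    (hUhc : IsCompact Uh) (hUhconv : Convex ℝ Uh) (hUhne : Uh.Nonempty)
    (hUtcl : IsClosed Ut) (hUtconv : Convex ℝ Ut) (hUtne : Ut.Nonempty)
    {F : X → X} (hF : ContinuousOn F (Uh + Ut)) (hcomp : IsCompact (closure (F '' (Uh + Ut))))
    (hR : ∀ u ∈ Uh + Ut, P (F u) ∈ Uh) (hRE : ∀ u ∈ Uh + Ut, F u - P (F u) ∈ Ut) :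
    ∃ u ∈ Uh + Ut, F u = u :=
  Literature.Analysis.Convex.exists_fixedPoint_of_isCompact_closure (hUhconv.add hUtconv)
    (isClosed_add_of_isCompact hUhc hUtcl) (hUhne.add hUtne) hF (mapsTo_add_of_split P hR hRE)
    hcomp

/-- The fixed point produced by `exists_fixedPoint_of_projectionSplit` lies in `F(U)`, as Nakao
states it ("there exists an element `u ∈ F(U)` such that `u = F(u)`"); recorded for faithfulness.
[cite: Nakao2001, §3 (3.7)] -/
theorem exists_fixedPoint_mem_image_of_projectionSplit (P : X → X) {Uh Ut : Set X}
    (hUhc : IsCompact Uh) (hUhconv : Convex ℝ Uh) (hUhne : Uh.Nonempty)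
    (hUtcl : IsClosed Ut) (hUtconv : Convex ℝ Ut) (hUtne : Ut.Nonempty)
    {F : X → X} (hF : ContinuousOn F (Uh + Ut)) (hcomp : IsCompact (closure (F '' (Uh + Ut))))
    (hR : ∀ u ∈ Uh + Ut, P (F u) ∈ Uh) (hRE : ∀ u ∈ Uh + Ut, F u - P (F u) ∈ Ut) :
    ∃ u ∈ F '' (Uh + Ut), F u = u := by
  obtain ⟨u, hu, hfix⟩ :=
    exists_fixedPoint_of_projectionSplit P hUhc hUhconv hUhne hUtcl hUtconv hUtne hF hcomp hR hRE
  exact ⟨u, ⟨u, hu, hfix⟩, hfix⟩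

/-! ### The infinite part as a ball in `ker P` (Nakao 2001 (3.11); Nakao–Watanabe 2011 (16)) -/

/-- The infinite part `U_⊥ = {φ : P φ = 0, ‖φ‖ ≤ α}` ("a ball in `S_h^⊥`", Nakao 2001 (3.11);
`[α]` of Nakao–Watanabe 2011 (16)) is closed, convex and (for `α ≥ 0`) nonempty, for a continuous
linear `P`. [cite: Nakao2001, §3 (3.11)] -/
theorem kerBall_closed_convex_nonempty (P : X →L[ℝ] X) {α : ℝ} (hα : 0 ≤ α) :
    IsClosed {φ : X | P φ = 0 ∧ ‖φ‖ ≤ α} ∧ Convex ℝ {φ : X | P φ = 0 ∧ ‖φ‖ ≤ α} ∧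
      ({φ : X | P φ = 0 ∧ ‖φ‖ ≤ α}).Nonempty := by
  have hset : {φ : X | P φ = 0 ∧ ‖φ‖ ≤ α} =
      ((LinearMap.ker (P : X →ₗ[ℝ] X) : Submodule ℝ X) : Set X) ∩ closedBall 0 α := by
    ext φ
    simp
  refine ⟨?_, ?_, ⟨0, by simp [hα]⟩⟩
  · rw [hset]
    exact (P.isClosed_ker).inter isClosed_closedBall
  · rw [hset]
    exact (LinearMap.ker (P : X →ₗ[ℝ] X)).convex.inter (convex_closedBall 0 α)

/-- **Nakao's verification principle, ball form of the infinite part.** Let `P : X →L[ℝ] X` be an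
idempotent continuous linear map (the projection `P_h` onto `S_h`; `ker P` plays `S_h^⊥`), `U_h` a
nonempty compact convex set, `α ≥ 0`, and `U = U_h + [α]` with `[α] = {φ : P φ = 0, ‖φ‖ ≤ α}`
(Nakao 2001 (3.11), Nakao–Watanabe 2011 (16)). If `F` is continuous and compact on `U`,
`P (F u) ∈ U_h` for all `u ∈ U` (rounding, first half of (3.8)/(17)) and `‖F u − P (F u)‖ ≤ α` for
all `u ∈ U` (rounding error, second half), then `u = F(u)` has a solution in `U`.
[cite: Nakao2001, §3 (3.8)–(3.11)] -/
theorem exists_fixedPoint_of_projectionSplit_ball (P : X →L[ℝ] X) (hP : ∀ x, P (P x) = P x)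
    {Uh : Set X} (hUhc : IsCompact Uh) (hUhconv : Convex ℝ Uh) (hUhne : Uh.Nonempty)
    {α : ℝ} (hα : 0 ≤ α) {F : X → X}
    (hF : ContinuousOn F (Uh + {φ : X | P φ = 0 ∧ ‖φ‖ ≤ α}))
    (hcomp : IsCompact (closure (F '' (Uh + {φ : X | P φ = 0 ∧ ‖φ‖ ≤ α}))))
    (hR : ∀ u ∈ Uh + {φ : X | P φ = 0 ∧ ‖φ‖ ≤ α}, P (F u) ∈ Uh)
    (hRE : ∀ u ∈ Uh + {φ : X | P φ = 0 ∧ ‖φ‖ ≤ α}, ‖F u - P (F u)‖ ≤ α) :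
    ∃ u ∈ Uh + {φ : X | P φ = 0 ∧ ‖φ‖ ≤ α}, F u = u := by
  obtain ⟨hcl, hconv, hne⟩ := kerBall_closed_convex_nonempty P hα
  refine exists_fixedPoint_of_projectionSplit P hUhc hUhconv hUhne hcl hconv hne hF hcomp hR ?_
  intro u hu
  refine ⟨?_, hRE u hu⟩
  rw [map_sub, hP, sub_self]

/-! ### The computable condition for the infinite part (Nakao 2001 Thm 3.1; NOLTA 2011 Thm 1) -/

omit [NormedSpace ℝ X] in
/-- **Mechanism of the infinite-part criterion.** If `F = K ∘ f` where the "solution operator" `K`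
satisfies the constructive a priori estimate `‖K ψ − P (K ψ)‖ ≤ C ‖ψ‖` for all `ψ` (Nakao 2001
(3.3)/(3.13): `‖φ − P_h φ‖_{H¹₀} ≤ C₀ h ‖Δφ‖`; Nakao–Watanabe 2011 (8): `C(h)`), `0 ≤ C`, and
`‖f u‖ ≤ M` for `u ∈ U`, then the rounding error satisfies `‖F u − P (F u)‖ ≤ C · M` on `U`
(so `β := C · sup_U ‖f u‖ ≤ α` puts it in the ball `[α]`, Nakao 2001 (3.18)–(3.19)).
[cite: Nakao2001, §3 (3.13), (3.18)] -/
theorem norm_sub_apply_comp_le {Y : Type*} [NormedAddCommGroup Y] (P : X → X) {K : Y → X}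
    {C : ℝ} (hC : 0 ≤ C) (hK : ∀ ψ, ‖K ψ - P (K ψ)‖ ≤ C * ‖ψ‖) {f : X → Y} {U : Set X} {M : ℝ}
    (hM : ∀ u ∈ U, ‖f u‖ ≤ M) {u : X} (hu : u ∈ U) :
    ‖K (f u) - P (K (f u))‖ ≤ C * M :=
  (hK (f u)).trans (mul_le_mul_of_nonneg_left (hM u hu) hC)

/-- **Nakao's Theorem 3.1 (abstract form of the FN-Int criterion).** Let `P : X →L[ℝ] X` be an
idempotent continuous linear map (`P_h`), `K : Y → X` a compact map (bounded sets to relatively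
compact sets; `K = (−Δ)⁻¹ : L² → H¹₀`) that is continuous and satisfies the a priori estimate
`‖K ψ − P (K ψ)‖ ≤ C ‖ψ‖` (`C = C₀ h`), `f : X → Y` continuous on the candidate set
`U = U_h + [α]`, `[α] = {φ : P φ = 0, ‖φ‖ ≤ α}`, with `‖f u‖ ≤ M` on `U`, and `F = K ∘ f`. If the
rounding condition `P (F u) ∈ U_h` holds on `U` (Nakao: `B_i ⊂ u_i + A_i`, `i = 1, …, n`, for the
interval solution `(B_i)` of `G · (B_i) = b`) and `β = C · M ≤ α`, "then there exists a solution `u`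
of `u = F(u)` in `U`" (Nakao 2001, Thm 3.1, p. 331; Nakao–Watanabe 2011 Thm 1 + Thm 2 ⟹ (17)).
[cite: Nakao2001, Thm 3.1] -/
theorem exists_fixedPoint_of_aprioriEstimate {Y : Type*} [NormedAddCommGroup Y]
    (P : X →L[ℝ] X) (hP : ∀ x, P (P x) = P x) {K : Y → X} (hKc : Continuous K)
    (hKcomp : ∀ s : Set Y, Bornology.IsBounded s → IsCompact (closure (K '' s)))
    {C : ℝ} (hC : 0 ≤ C) (hK : ∀ ψ, ‖K ψ - P (K ψ)‖ ≤ C * ‖ψ‖)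
    {Uh : Set X} (hUhc : IsCompact Uh) (hUhconv : Convex ℝ Uh) (hUhne : Uh.Nonempty)
    {α : ℝ} (hα : 0 ≤ α) {f : X → Y} (hf : ContinuousOn f (Uh + {φ : X | P φ = 0 ∧ ‖φ‖ ≤ α}))
    {M : ℝ} (hM : ∀ u ∈ Uh + {φ : X | P φ = 0 ∧ ‖φ‖ ≤ α}, ‖f u‖ ≤ M)
    (hR : ∀ u ∈ Uh + {φ : X | P φ = 0 ∧ ‖φ‖ ≤ α}, P (K (f u)) ∈ Uh) (hβ : C * M ≤ α) :
    ∃ u ∈ Uh + {φ : X | P φ = 0 ∧ ‖φ‖ ≤ α}, K (f u) = u := by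
  set U : Set X := Uh + {φ : X | P φ = 0 ∧ ‖φ‖ ≤ α} with hU
  -- `F = K ∘ f` is continuous on `U` and compact there (`f(U)` is bounded)
  have hF : ContinuousOn (fun u => K (f u)) U := hKc.comp_continuousOn hf
  have hbdd : Bornology.IsBounded (f '' U) :=
    isBounded_iff_forall_norm_le.2 ⟨M, fun y ⟨u, hu, hy⟩ => hy ▸ hM u hu⟩
  have hcomp : IsCompact (closure ((fun u => K (f u)) '' U)) := by
    have : (fun u => K (f u)) '' U = K '' (f '' U) := by
      rw [Set.image_image]
    rw [this]
    exact hKcomp _ hbdd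
  exact exists_fixedPoint_of_projectionSplit_ball P hP hUhc hUhconv hUhne hα hF hcomp hR
    fun u hu => (norm_sub_apply_comp_le P hC hK hM hu).trans hβ

end Literature.Analysis.ValidatedNumerics

end
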